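import Mathlib
import Literature.Analysis.UnboundedOperators.HeatKernelHeatEquation

/-!
# Crux `SlicedKelvin.PlanarFluxAPriori` (stmt-NavierStokesRegularity-15600), line `registered`:
  one-dimensional Gauss–Weierstrass kernel calculus (helper for `stub_heatKernelDomination`)

The heat-kernel domination step of the skeleton `Cruxes/PlanarFluxAPriori/Lines/birth.lean` tests a
bounded classical subsolution `φ(τ, c)` of `∂_τ − ν∂_c²` (the regularised planar flux profile in the
height `c`) against the ONE-DIMENSIONAL heat kernel `G_{ν(t−τ)}(c₀ − c)`. This file specialises the
tree's Gauss–Weierstrass kernel `Literature.Analysis.UnboundedOperators.heatKernel` (any finite-dimensional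
inner product space) to `E = ℝ` and records what the duality argument consumes:

* `heatKernel_real_eq` — `G_s(z) = (4πs)^{-1/2} e^{-z²/(4s)}`; `heatKernel_real_le` — the kernel sup
  `G_s(z) ≤ (4π)^{-1/2} s^{-1/2}` in the `1/√·` currency of the stub;
* `hasDerivAt_heatKernel_sub`, `hasDerivAt_heatKernel_sub_deriv` — `∂_c G_s(c₀−c) = ((c₀−c)/(2s)) G`,
  `∂_c² G_s(c₀−c) = W_s(c₀−c) G` with the caloric weight `W_s(z) = z²/(4s²) − 1/(2s)` (always written out);
  `hasDerivAt_heatKernel_time_real` — `∂_s G_s(z) = W_s(z) G_s(z)`: the kernel solves `∂_s G = ∂_z² G`;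
* `heatKernel_le_gaussian_of_mem_Icc`, `abs_weight_mul_heatKernel_le_gaussian_of_mem_Icc`,
  `abs_drift_mul_heatKernel_le_gaussian_of_mem_Icc` — Gaussian domination of `G`, `|W|G`, `|z/(2s)|G`
  UNIFORMLY for `s ∈ [s₀/2, 2s₀]` (the dominated-convergence bounds for differentiating under `∫ dc`);
* `integrable_of_abs_le_gaussian` — an integrand dominated by `C e^{-b(c₀−z)²}` is integrable (the form in
  which all kernel × bounded-data products of the duality argument are handled).

Tree (`heatKernel_eq`, `heatKernel_le`, `hasDerivAt_heatKernel_time`,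
`exists_abs_timeWeight_mul_heatKernel_le`, `one_add_pow_mul_exp_neg_mul_sq_le`) and Mathlib
(`integrable_exp_neg_mul_sq`). No fluid mechanics enters. Consumed by the pairing calculus
(`SlicedKelvinPlanarFluxAPrioriHeatPairing`) and the duality bound (`SlicedKelvinPlanarFluxAPrioriHeatDuality`).
-/

noncomputable section

-- Problem = summit for this single-conjunct summit: the duplicate namespace component is deliberate.
set_option linter.dupNamespace false

namespace Summit.NavierStokesRegularity.NavierStokesRegularity.Theorems.SlicedKelvinPlanarFluxAPriori

open MeasureTheory Set Real
open Literature.Analysis.UnboundedOperators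

/-! ### The kernel in dimension one -/

/-- In dimension one the Gauss–Weierstrass kernel reads `G_s(z) = (4πs)^{-1/2} e^{-z²/(4s)}`. -/
theorem heatKernel_real_eq (s z : ℝ) :
    heatKernel s z = (4 * π * s) ^ (-(1 : ℝ) / 2) * Real.exp (-(1 / (4 * s)) * z ^ 2) := by
  rw [heatKernel_eq, Module.finrank_self, Nat.cast_one, Real.norm_eq_abs, sq_abs]

/-- `(4πs)^{-1/2} = (4π)^{-1/2} · s^{-1/2}` in `1/√·` form (`0 < s`). -/
theorem rpow_neg_half_eq (s : ℝ) (hs : 0 < s) :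
    (4 * π * s) ^ (-(1 : ℝ) / 2) = 1 / Real.sqrt (4 * π) * (1 / Real.sqrt s) := by
  rw [show (-(1 : ℝ) / 2) = -(1 / 2) by ring, Real.rpow_neg (by positivity), ← Real.sqrt_eq_rpow,
    Real.sqrt_mul (by positivity) s, one_div_mul_one_div, one_div]

/-- **Kernel sup in the stub's currency**: `G_s(z) ≤ (4π)^{-1/2} s^{-1/2}` for `0 < s`. -/
theorem heatKernel_real_le {s : ℝ} (hs : 0 < s) (z : ℝ) :
    heatKernel s z ≤ 1 / Real.sqrt (4 * π) * (1 / Real.sqrt s) := by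
  have h := heatKernel_le (E := ℝ) hs z
  rwa [Module.finrank_self, Nat.cast_one, rpow_neg_half_eq s hs] at h

/-- The kernel is nonnegative for `0 < s` (restated in dimension one). -/
theorem heatKernel_real_nonneg {s : ℝ} (hs : 0 < s) (z : ℝ) : 0 ≤ heatKernel s z :=
  (heatKernel_pos (E := ℝ) hs z).le

/-! The caloric weight `W_s(z) = z²/(4s²) − 1/(2s)` (`∂_s G_s = W_s G_s = ∂_z² G_s` in dimension one)
is written out explicitly throughout (no definition is introduced). -/

/-! ### Space derivatives of `c ↦ G_s(c₀ − c)` -/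

/-- **First derivative**: `∂_c G_s(c₀ − c) = ((c₀ − c)/(2s)) · G_s(c₀ − c)` (`s ≠ 0`). -/
theorem hasDerivAt_heatKernel_sub {s : ℝ} (hs : s ≠ 0) (c₀ c : ℝ) :
    HasDerivAt (fun c => heatKernel s (c₀ - c))
      (heatKernel s (c₀ - c) * ((c₀ - c) / (2 * s))) c := by
  have hlin : HasDerivAt (fun c : ℝ => c₀ - c) (-1) c := by
    simpa using (hasDerivAt_id c).const_sub c₀
  have hsq : HasDerivAt (fun c : ℝ => -(1 / (4 * s)) * (c₀ - c) ^ 2)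
      (-(1 / (4 * s)) * (2 * (c₀ - c) * (-1))) c := by
    have := (hlin.pow 2).const_mul (-(1 / (4 * s)))
    simpa [pow_one] using this
  have hexp := hsq.exp
  have hmul := hexp.const_mul ((4 * π * s) ^ (-(1 : ℝ) / 2))
  have heq : (fun c => heatKernel s (c₀ - c)) =
      fun c => (4 * π * s) ^ (-(1 : ℝ) / 2) * Real.exp (-(1 / (4 * s)) * (c₀ - c) ^ 2) :=
    funext fun c => heatKernel_real_eq s (c₀ - c)
  rw [heq]
  refine hmul.congr_deriv ?_
  rw [heatKernel_real_eq]
  field_simp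
  ring

/-- **Second derivative**: `∂_c [((c₀ − c)/(2s)) G_s(c₀ − c)] = W_s(c₀ − c) · G_s(c₀ − c)` (`s ≠ 0`). -/
theorem hasDerivAt_heatKernel_sub_deriv {s : ℝ} (hs : s ≠ 0) (c₀ c : ℝ) :
    HasDerivAt (fun c => heatKernel s (c₀ - c) * ((c₀ - c) / (2 * s)))
      (((c₀ - c) ^ 2 / (4 * s ^ 2) - 1 / (2 * s)) * heatKernel s (c₀ - c)) c := by
  have h1 := hasDerivAt_heatKernel_sub hs c₀ c
  have h2 : HasDerivAt (fun c : ℝ => (c₀ - c) / (2 * s)) (-1 / (2 * s)) c := by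
    have := ((hasDerivAt_id c).const_sub c₀).div_const (2 * s)
    simpa using this
  refine (h1.mul h2).congr_deriv ?_
  field_simp
  ring

/-- **Time derivative in dimension one**: `∂_s G_s(z) = W_s(z) G_s(z)` for `0 < s` — with the second
space derivative above, the kernel solves the one-dimensional heat equation `∂_s G = ∂_z² G`. -/
theorem hasDerivAt_heatKernel_time_real : ∀ (s : ℝ), 0 < s → ∀ (z : ℝ), HasDerivAt (fun σ => Literature.Analysis.UnboundedOperators.heatKernel σ z) ((z ^ 2 / (4 * s ^ 2) - 1 / (2 * s)) * Literature.Analysis.UnboundedOperators.heatKernel s z) s := by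
  intro s hs z
  have h := hasDerivAt_heatKernel_time (E := ℝ) hs z
  rwa [Module.finrank_self, Nat.cast_one, Real.norm_eq_abs, sq_abs] at h

/-! ### Uniform Gaussian domination for `s ∈ [s₀/2, 2 s₀]` -/

/-- `G_s(z) ≤ (2πs₀)^{-1/2} e^{-z²/(8 s₀)}` for `s ∈ [s₀/2, 2s₀]`, `0 < s₀`. -/
theorem heatKernel_le_gaussian_of_mem_Icc {s₀ : ℝ} (hs₀ : 0 < s₀) {s : ℝ} (hs : s ∈ Icc (s₀ / 2) (2 * s₀))
    (z : ℝ) : heatKernel s z ≤ (4 * π * (s₀ / 2)) ^ (-(1 : ℝ) / 2) * Real.exp (-(1 / (8 * s₀)) * z ^ 2) := by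
  have hs0 : 0 < s := by linarith [hs.1]
  rw [heatKernel_real_eq]
  refine mul_le_mul ?_ ?_ (by positivity) (by positivity)
  · exact Real.rpow_le_rpow_of_nonpos (by positivity) (by nlinarith [hs.1, Real.pi_pos])
      (by rw [neg_div]; exact neg_nonpos.2 (by positivity))
  · refine Real.exp_le_exp.2 (mul_le_mul_of_nonneg_right (neg_le_neg ?_) (by positivity))
    exact one_div_le_one_div_of_le (by positivity) (by linarith [hs.2])

/-- `|W_s(z)| G_s(z) ≤ C e^{-z²/(16 s₀)}` uniformly for `s ∈ [s₀/2, 2s₀]` (the tree's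
`exists_abs_timeWeight_mul_heatKernel_le` in dimension one). -/
theorem abs_weight_mul_heatKernel_le_gaussian_of_mem_Icc {s₀ : ℝ} (hs₀ : 0 < s₀) :
    ∃ C, 0 ≤ C ∧ ∀ s ∈ Icc (s₀ / 2) (2 * s₀), ∀ z : ℝ,
      |z ^ 2 / (4 * s ^ 2) - 1 / (2 * s)| * heatKernel s z ≤ C * Real.exp (-(1 / (16 * s₀)) * z ^ 2) := by
  obtain ⟨C, hC0, hC⟩ := exists_abs_timeWeight_mul_heatKernel_le (E := ℝ) hs₀
  refine ⟨C, hC0, fun s hs z => ?_⟩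
  have h := hC s hs z
  rwa [Module.finrank_self, Nat.cast_one, Real.norm_eq_abs, sq_abs] at h

/-- `|z/(2s)| G_s(z) ≤ C e^{-z²/(16 s₀)}` uniformly for `s ∈ [s₀/2, 2s₀]` (the drift weight of the first
space derivative; `|z| ≤ (1 + |z|)²/… ` absorbed by `one_add_pow_mul_exp_neg_mul_sq_le`). -/
theorem abs_drift_mul_heatKernel_le_gaussian_of_mem_Icc {s₀ : ℝ} (hs₀ : 0 < s₀) :
    ∃ C, 0 ≤ C ∧ ∀ s ∈ Icc (s₀ / 2) (2 * s₀), ∀ z : ℝ,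
      |z / (2 * s)| * heatKernel s z ≤ C * Real.exp (-(1 / (16 * s₀)) * z ^ 2) := by
  set A : ℝ := (4 * π * (s₀ / 2)) ^ (-(1 : ℝ) / 2) with hA
  have hA0 : 0 ≤ A := by positivity
  have hb : 0 < 1 / (8 * s₀) := by positivity
  set D : ℝ := (Nat.factorial 1 : ℝ) * Real.exp (1 + 1 / (2 * (1 / (8 * s₀)))) with hD
  have hD0 : 0 ≤ D := by positivity
  refine ⟨1 / s₀ * A * D, by positivity, fun s hs z => ?_⟩
  have hs0 : 0 < s := by linarith [hs.1]
  have hw : |z / (2 * s)| ≤ 1 / s₀ * (1 + |z|) ^ 1 := by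
    rw [abs_div, abs_of_pos (by positivity : (0 : ℝ) < 2 * s), pow_one]
    rw [div_le_iff₀ (by positivity : (0 : ℝ) < 2 * s)]
    have h1 : |z| ≤ 1 + |z| := by linarith [abs_nonneg z]
    have h2 : (1 : ℝ) ≤ 1 / s₀ * (2 * s) := by
      rw [one_div, inv_mul_eq_div, le_div_iff₀ hs₀]; linarith [hs.1]
    calc |z| ≤ (1 + |z|) * 1 := by linarith
      _ ≤ (1 + |z|) * (1 / s₀ * (2 * s)) := by gcongr
      _ = 1 / s₀ * (1 + |z|) * (2 * s) := by ring
  have hK := heatKernel_le_gaussian_of_mem_Icc hs₀ hs z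
  have habs := one_add_pow_mul_exp_neg_mul_sq_le hb 1 (abs_nonneg z)
  have h16 : -(1 / (8 * s₀) / 2) = -(1 / (16 * s₀)) := by ring
  rw [h16, sq_abs] at habs
  calc |z / (2 * s)| * heatKernel s z
      ≤ (1 / s₀ * (1 + |z|) ^ 1) * (A * Real.exp (-(1 / (8 * s₀)) * z ^ 2)) :=
        mul_le_mul hw hK (heatKernel_real_nonneg hs0 z) (by positivity)
    _ = 1 / s₀ * A * ((1 + |z|) ^ 1 * Real.exp (-(1 / (8 * s₀)) * z ^ 2)) := by ring
    _ ≤ 1 / s₀ * A * (D * Real.exp (-(1 / (16 * s₀)) * z ^ 2)) := by gcongr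
    _ = 1 / s₀ * A * D * Real.exp (-(1 / (16 * s₀)) * z ^ 2) := by ring

/-! ### Integrability against bounded data -/

/-- A weighted Gaussian integrand dominated by `C e^{-b (c₀−z)²} B` is integrable: the form in which
the kernel products `G φ`, `(∂_c G) φ₁`, `(∂_c² G) φ`, … of the duality argument are shown integrable. -/
theorem integrable_of_abs_le_gaussian {b : ℝ} (hb : 0 < b) (c₀ : ℝ) {C : ℝ} {g : ℝ → ℝ}
    (hg : AEStronglyMeasurable g volume) (hle : ∀ z, |g z| ≤ C * Real.exp (-b * (c₀ - z) ^ 2)) :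
    Integrable g := by
  have h1 : Integrable (fun z : ℝ => C * Real.exp (-b * (c₀ - z) ^ 2)) :=
    ((integrable_exp_neg_mul_sq hb).comp_sub_left c₀).const_mul C
  refine h1.mono' hg (Filter.Eventually.of_forall fun z => ?_)
  rw [Real.norm_eq_abs]
  exact hle z


end Summit.NavierStokesRegularity.NavierStokesRegularity.Theorems.SlicedKelvinPlanarFluxAPriori

end
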